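import Summits.AtomisticToContinuum.Crystallization.Theorems.ChartedZeroExcessLayeredLatticeLiouvilleUZ

/-!
# Zero-excess layered lattice Liouville — part VA (lens-2 g57, node «PoincareZ» 1/2): index balls are CUBES; localised translate increments.

Second brick of (LD) `LinearExcessDecayZ` (the one every Campanato / hole-filling / compactness step needs next to Caccioppoli, part UZ):
the discrete POINCARÉ inequality on index balls.  This part: the sup-metric index ball `idxBallF x₀ n ⊆ ℤ² × ℤ` is a product of intervals
(`mem_idxBallF_of_between`: a site whose coordinates lie between those of two sites of the ball is in the ball), hence stable under the axis
legs of a displacement and under intermediate axis steps; the LOCALISED translate increment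
`dispSqOn Q φ t = Σ_{X ∈ Q, X + t ∈ Q} ‖φ(X + t) − φ(X)‖²` then obeys, on index balls, the telescoped Cauchy–Schwarz bound
`dispSqOn (k•e) ≤ k²·dispSqOn e` (every direction `e`), the symmetry `dispSqOn (−t) = dispSqOn t`, the three-legs bound
`dispSqOn v ≤ 3·(dispSqOn (v₁•e₁) + dispSqOn (v₂•e₂) + dispSqOn (v₃•e₃))`, and `dispSqOn e ≤ idxEnergy` for a unit step `e`.
Part VB sums these into the Poincaré inequality.  Configuration-free; nothing of the column is re-typed, nothing here is an item.
-/

noncomputable section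

open scoped BigOperators InnerProductSpace RealInnerProductSpace
open MeasureTheory Set Metric Filter Topology
open Summit.AtomisticToContinuum.Crystallization.Theorems.ChartedPlanarOrderRigidityDoor (E3 IsNash atomsIn)
open Summit.AtomisticToContinuum.Crystallization.Theorems.ChartedPlanarOrderDensityDichotomy (μS IsSep nK nK_nonneg)
open Summit.AtomisticToContinuum.Crystallization.Theorems.ChartedPlanarOrderDoorLayered (Layered layeredHom_eq_layered)

namespace Summit.AtomisticToContinuum.Crystallization.Theorems.ChartedZeroExcessLayeredLatticeLiouville

section PoincareCube

/-! ### VA.1  Index balls are cubes -/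

/-- Auxiliary step (`dist eq idxNorm`). [formal bookkeeping] -/
theorem dist_eq_idxNorm (X Y : Cell 2 × ℤ) : dist X Y = (idxNorm (Y - X) : ℝ) :=
  le_antisymm (dist_le_idxNorm X Y) (idxNorm_le_dist X Y)

/-- Auxiliary step (`mem idxBallF iff idxNorm`). [formal bookkeeping] -/
theorem mem_idxBallF_iff_idxNorm {x₀ X : Cell 2 × ℤ} {n : ℝ} : X ∈ idxBallF x₀ n ↔ (idxNorm (X - x₀) : ℝ) ≤ n := by
  rw [mem_idxBallF, dist_comm, dist_eq_idxNorm]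

/-- Auxiliary step (`idxBallF eq empty`). [formal bookkeeping] -/
theorem idxBallF_eq_empty {x₀ : Cell 2 × ℤ} {n : ℝ} (hn : n < 0) : idxBallF x₀ n = ∅ :=
  Finset.eq_empty_of_forall_notMem fun X hX => by
    have h := mem_idxBallF.mp hX
    linarith [dist_nonneg (x := X) (y := x₀)]

/-- Auxiliary step (`natAbs sub le of between`). [formal bookkeeping] -/
theorem natAbs_sub_le_of_between {u v x c : ℤ} (h1 : min u v ≤ x) (h2 : x ≤ max u v) :
    (x - c).natAbs ≤ max (u - c).natAbs (v - c).natAbs := by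
  omega

/-- ★ CUBE PROPERTY: a site each of whose three coordinates lies between the corresponding coordinates of two sites of an index ball lies in
the ball. [this file, g57] -/
theorem mem_idxBallF_of_between {x₀ U V X : Cell 2 × ℤ} {n : ℝ} (hU : U ∈ idxBallF x₀ n) (hV : V ∈ idxBallF x₀ n)
    (h1 : ∀ j : Fin 2, min (U.1 j) (V.1 j) ≤ X.1 j ∧ X.1 j ≤ max (U.1 j) (V.1 j))
    (h2 : min U.2 V.2 ≤ X.2 ∧ X.2 ≤ max U.2 V.2) : X ∈ idxBallF x₀ n := by
  rw [mem_idxBallF_iff_idxNorm] at hU hV ⊢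
  have c0 := natAbs_sub_le_of_between (c := x₀.1 0) (h1 0).1 (h1 0).2
  have c1 := natAbs_sub_le_of_between (c := x₀.1 1) (h1 1).1 (h1 1).2
  have c2 := natAbs_sub_le_of_between (c := x₀.2) h2.1 h2.2
  have key : idxNorm (X - x₀) ≤ max (idxNorm (U - x₀)) (idxNorm (V - x₀)) := by
    change max (max _ _) _ ≤ _
    refine max_le (max_le ?_ ?_) ?_
    · exact c0.trans (max_le_max (natAbs_fst_le_idxNorm (U - x₀) 0) (natAbs_fst_le_idxNorm (V - x₀) 0))
    · exact c1.trans (max_le_max (natAbs_fst_le_idxNorm (U - x₀) 1) (natAbs_fst_le_idxNorm (V - x₀) 1))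
    · exact c2.trans (max_le_max (natAbs_snd_le_idxNorm (U - x₀)) (natAbs_snd_le_idxNorm (V - x₀)))
  have key' : (idxNorm (X - x₀) : ℝ) ≤ max ((idxNorm (U - x₀) : ℝ)) (idxNorm (V - x₀) : ℝ) := by
    rw [← Nat.cast_max]; exact_mod_cast key
  exact key'.trans (max_le hU hV)

/-- Auxiliary step (`between add mul`). [formal bookkeeping] -/
theorem between_add_mul {x t : ℤ} {j k : ℕ} (hj : j ≤ k) :
    min x (x + k * t) ≤ x + j * t ∧ x + j * t ≤ max x (x + k * t) := by
  have hjk : (j : ℤ) ≤ k := by exact_mod_cast hj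
  rcases le_total 0 t with ht | ht
  · have h1 : (0 : ℤ) ≤ j * t := mul_nonneg (by positivity) ht
    have h2 : (j : ℤ) * t ≤ k * t := mul_le_mul_of_nonneg_right hjk ht
    exact ⟨(min_le_left _ _).trans (by linarith), (le_max_right _ _).trans' (by linarith)⟩
  · have h1 : (j : ℤ) * t ≤ 0 := mul_nonpos_iff.mpr (Or.inl ⟨by positivity, ht⟩)
    have h2 : (k : ℤ) * t ≤ j * t := mul_le_mul_of_nonpos_right hjk ht
    exact ⟨(min_le_right _ _).trans (by linarith), (le_max_left _ _).trans' (by linarith)⟩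

/-- Auxiliary step (`fst add nsmul`). [formal bookkeeping] -/
theorem fst_add_nsmul (X e : Cell 2 × ℤ) (j : ℕ) (i : Fin 2) : (X + j • e).1 i = X.1 i + j * e.1 i := by
  simp [nsmul_eq_mul]

/-- Auxiliary step (`snd add nsmul`). [formal bookkeeping] -/
theorem snd_add_nsmul (X e : Cell 2 × ℤ) (j : ℕ) : (X + j • e).2 = X.2 + j * e.2 := by
  simp [nsmul_eq_mul]

/-- INTERVAL PROPERTY: intermediate steps `X + j•e` (`j ≤ k`) between two sites `X`, `X + k•e` of an index ball stay in the ball — for EVERY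
direction `e`. [this file, g57] -/
theorem mem_idxBallF_add_nsmul_of_le {x₀ X e : Cell 2 × ℤ} {n : ℝ} {k j : ℕ} (hX : X ∈ idxBallF x₀ n)
    (hXk : X + k • e ∈ idxBallF x₀ n) (hj : j ≤ k) : X + j • e ∈ idxBallF x₀ n := by
  refine mem_idxBallF_of_between hX hXk (fun i => ?_) ?_
  · rw [fst_add_nsmul, fst_add_nsmul]; exact between_add_mul hj
  · rw [snd_add_nsmul, snd_add_nsmul]; exact between_add_mul hj

/-- AXIS LEGS: with `X` and `X + v` also the corners `X + v₁•e₁` and `X + v₁•e₁ + v₂•e₂` of the axis path lie in the ball. [this file, g57] -/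
theorem mem_idxBallF_legs {x₀ X v : Cell 2 × ℤ} {n : ℝ} (hX : X ∈ idxBallF x₀ n) (hXv : X + v ∈ idxBallF x₀ n) :
    X + v.1 0 • idxAxis₁ ∈ idxBallF x₀ n ∧ X + v.1 0 • idxAxis₁ + v.1 1 • idxAxis₂ ∈ idxBallF x₀ n := by
  constructor
  · refine mem_idxBallF_of_between hX hXv (fun i => ?_) ?_
    · fin_cases i <;> simp [idxAxis₁]
    · simp [idxAxis₁]
  · refine mem_idxBallF_of_between hX hXv (fun i => ?_) ?_
    · fin_cases i <;> simp [idxAxis₁, idxAxis₂]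
    · simp [idxAxis₁, idxAxis₂]

/-! ### VA.2  Localised translate increments -/

/-- the LOCALISED translate increment `dispSqOn Q φ t = Σ_{X ∈ Q, X + t ∈ Q} ‖φ(X + t) − φ(X)‖²`. [this file, g57] -/
def dispSqOn (Q : Finset (Cell 2 × ℤ)) (φ : Cell 2 → ℤ → E3) (t : Cell 2 × ℤ) : ℝ :=
  ∑ X ∈ Q, if X + t ∈ Q then dispSqFam φ t X else 0

/-- Auxiliary step (`dispSqOn nonneg`). [formal bookkeeping] -/
theorem dispSqOn_nonneg (Q : Finset (Cell 2 × ℤ)) (φ : Cell 2 → ℤ → E3) (t : Cell 2 × ℤ) : 0 ≤ dispSqOn Q φ t :=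
  Finset.sum_nonneg fun X _ => by split_ifs; exacts [dispSqFam_nonneg φ t X, le_rfl]

/-- REINDEXING: a shifted family of increments, restricted to `X + v ∈ Q`, is dominated by `dispSqOn Q φ t` as soon as the shifted bonds stay in
`Q`. [this file, g57] -/
theorem sum_ite_dispSqFam_shift_le (Q : Finset (Cell 2 × ℤ)) (φ : Cell 2 → ℤ → E3) {v s t : Cell 2 × ℤ}
    (h : ∀ X ∈ Q, X + v ∈ Q → X + s ∈ Q ∧ X + s + t ∈ Q) :
    (∑ X ∈ Q, if X + v ∈ Q then dispSqFam φ t (X + s) else 0) ≤ dispSqOn Q φ t := by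
  rw [← Finset.sum_filter]
  have hinj : Set.InjOn (fun X : Cell 2 × ℤ => X + s) ↑(Q.filter fun X => X + v ∈ Q) := (add_left_injective s).injOn
  have e1 : ∑ X ∈ Q.filter (fun X => X + v ∈ Q), dispSqFam φ t (X + s) =
      ∑ Z ∈ (Q.filter fun X => X + v ∈ Q).image (fun X => X + s), dispSqFam φ t Z :=
    (Finset.sum_image (f := dispSqFam φ t) hinj).symm
  unfold dispSqOn
  rw [e1, ← Finset.sum_filter]
  refine Finset.sum_le_sum_of_subset_of_nonneg (fun Z hZ => ?_) fun Z _ _ => dispSqFam_nonneg φ t Z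
  obtain ⟨X, hX, rfl⟩ := Finset.mem_image.mp hZ
  obtain ⟨hXQ, hXv⟩ := Finset.mem_filter.mp hX
  exact Finset.mem_filter.mpr (h X hXQ hXv)

/-- TELESCOPED CAUCHY–SCHWARZ, pointwise: `‖φ(X + k•e) − φ(X)‖² ≤ k · Σ_{j<k} ‖φ(X + (j+1)•e) − φ(X + j•e)‖²`. -/
theorem dispSqFam_nsmul_le (φ : Cell 2 → ℤ → E3) (X e : Cell 2 × ℤ) (k : ℕ) :
    dispSqFam φ (k • e) X ≤ k * ∑ j ∈ Finset.range k, dispSqFam φ e (X + j • e) := by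
  have hstep : ∀ j : ℕ, X + (j + 1) • e = X + j • e + e := fun j => by rw [succ_nsmul, add_assoc]
  unfold dispSqFam
  have htel : φ (X + k • e).1 (X + k • e).2 - φ X.1 X.2 =
      ∑ j ∈ Finset.range k, (φ (X + (j + 1) • e).1 (X + (j + 1) • e).2 - φ (X + j • e).1 (X + j • e).2) := by
    rw [Finset.sum_range_sub (fun j => φ (X + j • e).1 (X + j • e).2) k]
    simp only [zero_smul, add_zero]
  rw [htel]
  calc ‖∑ j ∈ Finset.range k, (φ (X + (j + 1) • e).1 (X + (j + 1) • e).2 - φ (X + j • e).1 (X + j • e).2)‖ ^ 2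
      ≤ (∑ j ∈ Finset.range k, ‖φ (X + (j + 1) • e).1 (X + (j + 1) • e).2 - φ (X + j • e).1 (X + j • e).2‖) ^ 2 :=
        pow_le_pow_left₀ (norm_nonneg _) (norm_sum_le _ _) 2
    _ ≤ (Finset.range k).card *
          ∑ j ∈ Finset.range k, ‖φ (X + (j + 1) • e).1 (X + (j + 1) • e).2 - φ (X + j • e).1 (X + j • e).2‖ ^ 2 :=
        sq_sum_le_card_mul_sum_sq
    _ = k * ∑ j ∈ Finset.range k, ‖φ (X + j • e + e).1 (X + j • e + e).2 - φ (X + j • e).1 (X + j • e).2‖ ^ 2 := by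
        rw [Finset.card_range]
        exact congrArg _ (Finset.sum_congr rfl fun j _ => by rw [hstep])

/-- ★ `dispSqOn (k•e) ≤ k² · dispSqOn e` on index balls, for EVERY direction `e` (path-free: telescoping + reindexing + interval property).
[giaquinta1984 Ch. III §2; this file, g57] -/
theorem dispSqOn_nsmul_le (x₀ : Cell 2 × ℤ) (n : ℝ) (φ : Cell 2 → ℤ → E3) (e : Cell 2 × ℤ) (k : ℕ) :
    dispSqOn (idxBallF x₀ n) φ (k • e) ≤ (k : ℝ) ^ 2 * dispSqOn (idxBallF x₀ n) φ e := by
  have h1 : dispSqOn (idxBallF x₀ n) φ (k • e) ≤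
      ∑ X ∈ idxBallF x₀ n, (k : ℝ) * ∑ j ∈ Finset.range k,
        (if X + k • e ∈ idxBallF x₀ n then dispSqFam φ e (X + j • e) else 0) := by
    unfold dispSqOn
    refine Finset.sum_le_sum fun X _ => ?_
    split_ifs
    · exact dispSqFam_nsmul_le φ X e k
    · simp
  have h2 : ∀ j ∈ Finset.range k,
      (∑ X ∈ idxBallF x₀ n, if X + k • e ∈ idxBallF x₀ n then dispSqFam φ e (X + j • e) else 0) ≤
        dispSqOn (idxBallF x₀ n) φ e := fun j hj =>
    sum_ite_dispSqFam_shift_le _ φ fun X hX hXk =>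
      ⟨mem_idxBallF_add_nsmul_of_le hX hXk (Finset.mem_range.mp hj).le, by
        rw [add_assoc, ← succ_nsmul]
        exact mem_idxBallF_add_nsmul_of_le hX hXk (Finset.mem_range.mp hj)⟩
  calc dispSqOn (idxBallF x₀ n) φ (k • e)
      ≤ ∑ X ∈ idxBallF x₀ n, (k : ℝ) * ∑ j ∈ Finset.range k,
          (if X + k • e ∈ idxBallF x₀ n then dispSqFam φ e (X + j • e) else 0) := h1
    _ = (k : ℝ) * ∑ j ∈ Finset.range k, ∑ X ∈ idxBallF x₀ n,
          (if X + k • e ∈ idxBallF x₀ n then dispSqFam φ e (X + j • e) else 0) := by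
        rw [← Finset.mul_sum, Finset.sum_comm]
    _ ≤ (k : ℝ) * ∑ j ∈ Finset.range k, dispSqOn (idxBallF x₀ n) φ e :=
        mul_le_mul_of_nonneg_left (Finset.sum_le_sum h2) (by positivity)
    _ = (k : ℝ) ^ 2 * dispSqOn (idxBallF x₀ n) φ e := by
        rw [Finset.sum_const, Finset.card_range, nsmul_eq_mul]; ring

/-- Auxiliary step (`dispSqOn neg`). [formal bookkeeping] -/
theorem dispSqOn_neg (Q : Finset (Cell 2 × ℤ)) (φ : Cell 2 → ℤ → E3) (t : Cell 2 × ℤ) :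
    dispSqOn Q φ (-t) = dispSqOn Q φ t := by
  unfold dispSqOn
  rw [← Finset.sum_filter, ← Finset.sum_filter]
  refine Finset.sum_equiv (Equiv.addRight (-t)) (fun X => ?_) (fun X _ => ?_)
  · simp only [Finset.mem_filter, Equiv.coe_addRight, neg_add_cancel_right]
    exact and_comm
  · simp only [Equiv.coe_addRight]
    unfold dispSqFam
    rw [neg_add_cancel_right, norm_sub_rev]

/-- Auxiliary step (`dispSqOn zsmul le`). [formal bookkeeping] -/
theorem dispSqOn_zsmul_le (x₀ : Cell 2 × ℤ) (n : ℝ) (φ : Cell 2 → ℤ → E3) (e : Cell 2 × ℤ) (z : ℤ) :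
    dispSqOn (idxBallF x₀ n) φ (z • e) ≤ (z : ℝ) ^ 2 * dispSqOn (idxBallF x₀ n) φ e := by
  have hcast : (((z.natAbs : ℕ)) : ℝ) ^ 2 = (z : ℝ) ^ 2 := by rw [Nat.cast_natAbs, Int.cast_abs, sq_abs]
  rcases Int.natAbs_eq z with hz | hz
  · have h := dispSqOn_nsmul_le x₀ n φ e z.natAbs
    rw [← natCast_zsmul, ← hz, hcast] at h
    exact h
  · have h := dispSqOn_nsmul_le x₀ n φ e z.natAbs
    rw [← natCast_zsmul, hcast, ← dispSqOn_neg, ← neg_zsmul, ← hz] at h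
    exact h

/-! ### VA.3  The three axis legs -/

/-- Auxiliary step (`norm add₃ sq le`). [formal bookkeeping] -/
theorem norm_add₃_sq_le (A B C : E3) : ‖A + B + C‖ ^ 2 ≤ 3 * (‖A‖ ^ 2 + ‖B‖ ^ 2 + ‖C‖ ^ 2) := by
  have h1 : ‖A + B + C‖ ^ 2 ≤ (‖A‖ + ‖B‖ + ‖C‖) ^ 2 := pow_le_pow_left₀ (norm_nonneg _) norm_add₃_le 2
  nlinarith [sq_nonneg (‖A‖ - ‖B‖), sq_nonneg (‖B‖ - ‖C‖), sq_nonneg (‖A‖ - ‖C‖)]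

/-- pointwise three-legs bound along the axis path `X → X + v₁e₁ → X + v₁e₁ + v₂e₂ → X + v`. -/
theorem dispSqFam_le_three_legs (φ : Cell 2 → ℤ → E3) (X v : Cell 2 × ℤ) :
    dispSqFam φ v X ≤ 3 * (dispSqFam φ (v.1 0 • idxAxis₁) (X + 0) +
      dispSqFam φ (v.1 1 • idxAxis₂) (X + v.1 0 • idxAxis₁) +
      dispSqFam φ (v.2 • idxAxis₃) (X + (v.1 0 • idxAxis₁ + v.1 1 • idxAxis₂))) := by
  have hv : X + v = X + (v.1 0 • idxAxis₁ + v.1 1 • idxAxis₂) + v.2 • idxAxis₃ := by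
    conv_lhs => rw [idx_decomp v]
    abel
  unfold dispSqFam
  rw [hv, add_zero, ← add_assoc X]
  have hsplit : φ (X + v.1 0 • idxAxis₁ + v.1 1 • idxAxis₂ + v.2 • idxAxis₃).1 (X + v.1 0 • idxAxis₁ + v.1 1 • idxAxis₂ + v.2 • idxAxis₃).2
      - φ X.1 X.2 =
      (φ (X + v.1 0 • idxAxis₁).1 (X + v.1 0 • idxAxis₁).2 - φ X.1 X.2) +
      (φ (X + v.1 0 • idxAxis₁ + v.1 1 • idxAxis₂).1 (X + v.1 0 • idxAxis₁ + v.1 1 • idxAxis₂).2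
        - φ (X + v.1 0 • idxAxis₁).1 (X + v.1 0 • idxAxis₁).2) +
      (φ (X + v.1 0 • idxAxis₁ + v.1 1 • idxAxis₂ + v.2 • idxAxis₃).1 (X + v.1 0 • idxAxis₁ + v.1 1 • idxAxis₂ + v.2 • idxAxis₃).2
        - φ (X + v.1 0 • idxAxis₁ + v.1 1 • idxAxis₂).1 (X + v.1 0 • idxAxis₁ + v.1 1 • idxAxis₂).2) := by
    abel
  rw [hsplit]
  exact norm_add₃_sq_le _ _ _

/-- ★ THREE LEGS: `dispSqOn v ≤ 3·(dispSqOn (v₁•e₁) + dispSqOn (v₂•e₂) + dispSqOn (v₃•e₃))` on index balls. [this file, g57] -/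
theorem dispSqOn_le_three_legs (x₀ : Cell 2 × ℤ) (n : ℝ) (φ : Cell 2 → ℤ → E3) (v : Cell 2 × ℤ) :
    dispSqOn (idxBallF x₀ n) φ v ≤ 3 * (dispSqOn (idxBallF x₀ n) φ (v.1 0 • idxAxis₁) +
      dispSqOn (idxBallF x₀ n) φ (v.1 1 • idxAxis₂) + dispSqOn (idxBallF x₀ n) φ (v.2 • idxAxis₃)) := by
  have hv : ∀ X : Cell 2 × ℤ, X + v = X + (v.1 0 • idxAxis₁ + v.1 1 • idxAxis₂) + v.2 • idxAxis₃ := fun X => by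
    conv_lhs => rw [idx_decomp v]
    abel
  have hpt : ∀ X ∈ idxBallF x₀ n, (if X + v ∈ idxBallF x₀ n then dispSqFam φ v X else 0) ≤
      3 * ((if X + v ∈ idxBallF x₀ n then dispSqFam φ (v.1 0 • idxAxis₁) (X + 0) else 0) +
        (if X + v ∈ idxBallF x₀ n then dispSqFam φ (v.1 1 • idxAxis₂) (X + v.1 0 • idxAxis₁) else 0) +
        (if X + v ∈ idxBallF x₀ n then dispSqFam φ (v.2 • idxAxis₃) (X + (v.1 0 • idxAxis₁ + v.1 1 • idxAxis₂)) else 0)) := by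
    intro X _
    split_ifs
    · exact dispSqFam_le_three_legs φ X v
    · simp
  have hA : (∑ X ∈ idxBallF x₀ n, if X + v ∈ idxBallF x₀ n then dispSqFam φ (v.1 0 • idxAxis₁) (X + 0) else 0) ≤
      dispSqOn (idxBallF x₀ n) φ (v.1 0 • idxAxis₁) :=
    sum_ite_dispSqFam_shift_le _ φ fun X hX hXv => ⟨by rw [add_zero]; exact hX, by
      rw [add_zero]; exact (mem_idxBallF_legs hX hXv).1⟩
  have hB : (∑ X ∈ idxBallF x₀ n, if X + v ∈ idxBallF x₀ n then dispSqFam φ (v.1 1 • idxAxis₂) (X + v.1 0 • idxAxis₁) else 0) ≤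
      dispSqOn (idxBallF x₀ n) φ (v.1 1 • idxAxis₂) :=
    sum_ite_dispSqFam_shift_le _ φ fun X hX hXv => mem_idxBallF_legs hX hXv
  have hC : (∑ X ∈ idxBallF x₀ n,
      if X + v ∈ idxBallF x₀ n then dispSqFam φ (v.2 • idxAxis₃) (X + (v.1 0 • idxAxis₁ + v.1 1 • idxAxis₂)) else 0) ≤
      dispSqOn (idxBallF x₀ n) φ (v.2 • idxAxis₃) :=
    sum_ite_dispSqFam_shift_le _ φ fun X hX hXv => ⟨by rw [← add_assoc]; exact (mem_idxBallF_legs hX hXv).2, by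
      rw [← hv X]; exact hXv⟩
  unfold dispSqOn at hA hB hC ⊢
  calc (∑ X ∈ idxBallF x₀ n, if X + v ∈ idxBallF x₀ n then dispSqFam φ v X else 0)
      ≤ ∑ X ∈ idxBallF x₀ n, 3 * ((if X + v ∈ idxBallF x₀ n then dispSqFam φ (v.1 0 • idxAxis₁) (X + 0) else 0) +
          (if X + v ∈ idxBallF x₀ n then dispSqFam φ (v.1 1 • idxAxis₂) (X + v.1 0 • idxAxis₁) else 0) +
          (if X + v ∈ idxBallF x₀ n then dispSqFam φ (v.2 • idxAxis₃) (X + (v.1 0 • idxAxis₁ + v.1 1 • idxAxis₂)) else 0)) :=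
        Finset.sum_le_sum hpt
    _ = 3 * ((∑ X ∈ idxBallF x₀ n, if X + v ∈ idxBallF x₀ n then dispSqFam φ (v.1 0 • idxAxis₁) (X + 0) else 0) +
          (∑ X ∈ idxBallF x₀ n, if X + v ∈ idxBallF x₀ n then dispSqFam φ (v.1 1 • idxAxis₂) (X + v.1 0 • idxAxis₁) else 0) +
          (∑ X ∈ idxBallF x₀ n,
            if X + v ∈ idxBallF x₀ n then dispSqFam φ (v.2 • idxAxis₃) (X + (v.1 0 • idxAxis₁ + v.1 1 • idxAxis₂)) else 0)) := by
        rw [← Finset.mul_sum, Finset.sum_add_distrib, Finset.sum_add_distrib]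
    _ ≤ _ := by linarith

/-! ### VA.4  A unit step is dominated by the localised energy -/

/-- Auxiliary step (`idxEnergy coe finset`). [formal bookkeeping] -/
theorem idxEnergy_coe_finset (φ : Cell 2 → ℤ → E3) (Q : Finset (Cell 2 × ℤ)) :
    idxEnergy φ ↑Q = ∑ x ∈ (Q ×ˢ Q).filter (fun x => dist x.1 x.2 ≤ 1), ‖φ x.2.1 x.2.2 - φ x.1.1 x.1.2‖ ^ 2 := by
  have hS : {x : (Cell 2 × ℤ) × (Cell 2 × ℤ) | x.1 ∈ (↑Q : Set (Cell 2 × ℤ)) ∧ x.2 ∈ (↑Q : Set (Cell 2 × ℤ)) ∧ dist x.1 x.2 ≤ 1} =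
      ↑((Q ×ˢ Q).filter (fun x => dist x.1 x.2 ≤ 1)) := by
    ext x
    simp [and_assoc]
  unfold idxEnergy
  rw [hS, finsum_mem_coe_finset]

/-- `dispSqOn Q φ e ≤ idxEnergy φ Q` for a unit step `e`. [this file, g57] -/
theorem dispSqOn_le_idxEnergy (Q : Finset (Cell 2 × ℤ)) (φ : Cell 2 → ℤ → E3) {e : Cell 2 × ℤ}
    (he : ∀ U : Cell 2 × ℤ, dist U (U + e) ≤ 1) : dispSqOn Q φ e ≤ idxEnergy φ ↑Q := by
  unfold dispSqOn
  rw [← Finset.sum_filter, idxEnergy_coe_finset]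
  have hinj : Set.InjOn (fun X : Cell 2 × ℤ => ((X, X + e) : (Cell 2 × ℤ) × (Cell 2 × ℤ))) ↑(Q.filter fun X => X + e ∈ Q) :=
    fun X _ Y _ h => (Prod.ext_iff.mp h).1
  have e1 : ∑ X ∈ Q.filter (fun X => X + e ∈ Q), dispSqFam φ e X =
      ∑ x ∈ (Q.filter fun X => X + e ∈ Q).image (fun X => ((X, X + e) : (Cell 2 × ℤ) × (Cell 2 × ℤ))),
        ‖φ x.2.1 x.2.2 - φ x.1.1 x.1.2‖ ^ 2 := by
    rw [Finset.sum_image hinj]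
    exact Finset.sum_congr rfl fun X _ => rfl
  rw [e1]
  refine Finset.sum_le_sum_of_subset_of_nonneg (fun x hx => ?_) fun x _ _ => sq_nonneg _
  obtain ⟨X, hX, rfl⟩ := Finset.mem_image.mp hx
  obtain ⟨hXQ, hXe⟩ := Finset.mem_filter.mp hX
  exact Finset.mem_filter.mpr ⟨Finset.mem_product.mpr ⟨hXQ, hXe⟩, he X⟩

/-- the sum of the three axis unit-step increments is at most `3 · idxEnergy`. [this file, g57] -/
theorem dispSqOn_axes_le (Q : Finset (Cell 2 × ℤ)) (φ : Cell 2 → ℤ → E3) :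
    dispSqOn Q φ idxAxis₁ + dispSqOn Q φ idxAxis₂ + dispSqOn Q φ idxAxis₃ ≤ 3 * idxEnergy φ ↑Q := by
  have h1 := dispSqOn_le_idxEnergy Q φ dist_add_idxAxis₁_le
  have h2 := dispSqOn_le_idxEnergy Q φ dist_add_idxAxis₂_le
  have h3 := dispSqOn_le_idxEnergy Q φ dist_add_idxAxis₃_le
  linarith

end PoincareCube

end Summit.AtomisticToContinuum.Crystallization.Theorems.ChartedZeroExcessLayeredLatticeLiouville

end
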